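import Mathlib
import HarnessLib
import HarnessLib.Audit
import Summits.CriticalPhenomena.Statement

/-!
Route: PercBudgetLadder

# Route PercBudgetLadder — RSW in the budget variable — from Zhang's zero critical flow constant via
bounded-budget tightness and pinhole closing to blocked critical annuli, hence θ(p_c)=0

It suffices to show X = CritAnnulusBlockedIO: for some aspect ratio λ ≥ 2 and some c > 0, for
INFINITELY MANY n the
critical annulus B(n) → ∂B(λn) of ℤ³ is blocked (no open path inside B(λn) from the box B(n) = box 3
n to the inner vertex
boundary of B(λn)) with P_{p_c}-probability ≥ c. This is the i.o./thick-annulus weakening of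
PercAnnulusCrossing's X_B, and it
is reached here by the BUDGET LADDER of card maxflow-budget-ladder (spine, the only card realised):
write MinCut(n,λn)(ω) ≤ k for
"the open crossings of the annulus can all be destroyed by closing at most k edges" (= at most k
open edges on an edge cutset =
by Menger at most k edge-disjoint open crossings); X is the rung k = 0, Zhang's theorem (critical
flow constant zero, E MinCut =
o(n²)) is the proved rung at the bottom, and the two cruxes are bounded-budget tightness (r2) and
pinhole closing (r3), whose
conjunction gives X by a k-step descent; θ > 0 would force the blocking probability to 0 (zero-one
law), so X gives θ(p_c) = 0.
Lean: `∃ (l : ℕ) (c : ℝ), 2 ≤ l ∧ 0 < c ∧ ∀ N : ℕ, ∃ n : ℕ, N ≤ n ∧ c ≤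
(Literature.Probability.Percolation.bondPercolation (Literature.Probability.LatticeModels.zdGraph 3)
(Literature.Probability.Percolation.criticalProbI 3)).real {ω | ¬ ∃ x ∈
Literature.Probability.LatticeModels.box 3 n, ∃ y ∈
Literature.Probability.LatticeModels.innerBoundary (Literature.Probability.LatticeModels.zdGraph 3)
(Literature.Probability.LatticeModels.box 3 (l * n)), ω ∈
Literature.Probability.Percolation.openConnIn ↑(Literature.Probability.LatticeModels.box 3 (l * n))
x y}`

## Assembly
Pure logic, proved sorry-free in the planner's AssemblyCheck.lean over definitional copies of the
decls: from BudgetTightness get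
(k, λ, c); apply PinholeClosing k times (descent j ↦ j−1: budget k at aspect λ' with probability ≥
c_j for infinitely many n ≥ 1
gives budget k−1 at aspect 2λ' with probability ≥ c_(j+1) for the same n), reaching budget 0 at
aspect 2^k λ ≥ 2; budget 0 is
literally the blocked event (S.card ≤ 0 forces S = ∅ and ω \ ∅ = ω), i.e. CritAnnulusBlockedIO; if
θ(p_c) ≠ 0 then θ(p_c) > 0
and BlockingVanishesOfTheta at p = p_c, aspect 2^k λ, makes the blocking probability eventually <
c_k — contradiction. Hence
θ(p_c) = 0, which is PercolationContinuityZ3 by percolationContinuityZ3_iff. ZhangBase (the proved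
base rung L0) is deliberately not a hypothesis of the Assembly; the milestone rung L1
(DefectDimension: blocking budget ≤ n^(2−c) w.h.p.) was carried as a non-load-bearing crux until
2026-08-16 and then dropped
(unused-crux repair) once its provable content had landed — see RANKED CRUXES / KILL CRITERIA in the
rationale.

Rationale: WHY THIS LINE. Dualise 3-D RSW by max-flow/min-cut instead of plaquette topology (Grimmett1999
§13.1, PDF p.393: the critical atom of the
capacity law is 1 − p_c(3)): the blocking objects are edge cutsets with a BUDGET of open edges
("pinholes"), and unlike open
paths (barrier TransverseCrossingsNeedNotMeet) cutsets of overlapping regions compose by union with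
budgets adding, which is why
first-passage/max-flow theory has laws of large numbers and continuity theorems in d = 3
(Kesten1987, Zhang2017,
RossignolTheret2018) while nothing comparable exists for crossings. The base rung is a THEOREM
pointing in the upper-RSW
direction and unused by every other route: ν(p_c) = 0 (Zhang2000; RossignolTheret2018 Thm 2.3 and
Prop 3.9, read pp.16–17),
proved from Barsky–Grimmett–Newman θ_ℍ(p_c) = 0 — in the tree as
Literature.Probability.Percolation.BarskyGrimmettNewman1991_Z3_holds
— by a half-space cutset, so critical blocking surfaces with a sub-areal number of pinholes exist
w.h.p. The top rungs are the
Menger duals of the hyperscaling picture (Aizenman1997, BorgsChayesKestenSpencer1999: tight spanning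
structures for d < 6,
≍ L^(d−6) spanning clusters for d > 6): r2 says the critical max-flow through an annulus is tight
along a subsequence, r3 is
the Russo–Seymour–Welsh statement in the budget variable (one pinhole can be closed at bounded cost
by doubling the aspect
ratio, uniformly in n; Grimmett1999 §11.7 is the d = 2 template). Imported areas: first-passage
percolation / max-flow–min-cut
(Kesten, Zhang, Rossignol–Théret), Menger–BK combinatorics, hyperscaling phenomenology; no
renormalisation in p, no slab limit.
Versus prior routes: PercAnnulusCrossing compares SHAPES at budget 0 (Benjamini–Kalai plaquette RSW,
open); this route
compares BUDGETS at fixed shape and starts from a proved base; the negatives index (1 SAW statement)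
is untouched.

RANKED CRUXES. #0 CritAnnulusBlockedIO (target) — X: there are λ ≥ 2 and c > 0 such that for
infinitely many n, with P_{p_c(ℤ³)}-probability ≥ c there is no open path inside B(λn) from box 3 n
to innerBoundary (zdGraph 3) (box 3 (λn)) (the i.o., aspect-λ weakening of
PercAnnulusCrossing.CritAnnulusNonCrossing; numerically blocking probabilities converge to constants
in (0,1)). (why it might fail: False iff critical annuli of every aspect ratio are crossed with
probability → 1 — the picture PROVED for d>6 under η=0 (Aizenman1997 Thm 4; barrier
SpanningClustersAboveSix); in d=3 only numerics (R_c≈0.258) and slab analogues (NTW2017, c(k)→0)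
support it.) [Aizenman1997, BorgsChayesKestenSpencer1999, NewmanTassionWu2017, arXiv:1302.0421,
Grimmett1999]
#2 BudgetTightness (crux) — bounded-budget tightness at p_c (card rung L3 with k free): there are k,
λ ≥ 2 and c > 0 such that for infinitely many n, with probability ≥ c the open crossings of the
annulus B(n) → ∂B(λn) inside B(λn) can all be destroyed by closing at most k edges (MinCut(n,λn) ≤
k; by Menger: at most k edge-disjoint open crossings; by BK it is implied by X, so it is the
NECESSARY half of the ladder and the Menger dual of 'tight number of disjoint spanning structures',
the d<6 side of hyperscaling). [difficulty: open-problem] (why it might fail: False iff the critical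
max-flow MinCut(n,λn) → ∞ in probability for all λ — true for d>6 (≥ #spanning clusters ≍ n^(d−6),
Aizenman1997), so a proof must use d=3; the only d=3 handle is Zhang's o(n²), and a jump world may
keep budgets tight OR not.) [Aizenman1997, BorgsChayesKestenSpencer1999, Zhang2000,
RossignolTheret2018, Literature.Barriers.CriticalPhenomena.SpanningClustersAboveSix,
arXiv:1302.0421]
#3 PinholeClosing (crux) — pinhole closing = RSW in the budget variable (card rung L3→L4, made
uniform): for all k, λ ≥ 2 and c > 0 there is c' > 0 such that for EVERY n ≥ 1, if with probability
≥ c the annulus B(n) → ∂B(λn) can be blocked by closing at most k+1 edges, then with probability ≥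
c' the thicker annulus B(n) → ∂B(2λn) can be blocked by closing at most k edges. With r2 and a
k-step descent this yields X at aspect 2^k λ. Off-critical content is nil by design (stated at p_c);
brute-force finite energy gives only c'(n) ≍ c·n^(−3) (entropy of the pinhole position), so the
content is 'one pinhole costs O(1), given room'. [deps: BudgetTightness] [difficulty: open-problem]
(why it might fail: Closing a pinhole by brute force costs the entropy n³ of its position; bounded
cost needs a shape/scale comparison for near-closed cutsets with no planar tool (Tassion/KST use the
ORDER of landing points). In a jump world with tight budgets it is false (s_n → 0).) [Grimmett1999,
BenjaminiKalai2018, NewmanTassionWu2017, arXiv:1410.6773, arXiv:2011.04618,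
Literature.Barriers.CriticalPhenomena.TransverseCrossingsNeedNotMeet]
#— DefectDimension (DROPPED 2026-08-16, unused-crux repair; was crux r4,
stmt-CriticalPhenomena-5250) — the milestone rung L1 'defect dimension < 2' (∃ c > 0,
P_{p_c}(A(n,2n) blockable by closing ≤ n^(2−c) edges) → 1) was by design outside the deciding
theorem `closes` and no honest glue into it exists: every feeder relation found runs DOWNSTREAM of
the target family, never upstream of r2/r3 — QuantitativeBGN ⇒ L1 (the proved support
DefectDimensionOfQuantBGN, kept: its statement inlines both sides) and T_δ ⇒ L1, where T_δ =
'critical chemical distance across A(n,2n) is ≥ n^(1+s) with probability ≥ δ' (registered stub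
`stub_weakTortuosity` of line chemical-tortuosity-packing) composes with the LANDED Theorems
stub_packing (p76643: chemical distance ≥ ℓ ⇒ budget ≤ 3(4n+1)³/ℓ) and stub_bootstrap (p79208:
δ-form power saving ⇒ w.h.p. power saving by Efron–Stein + Chebyshev, so L1 ⟺ its δ-form), while
T_δ's only blueprint (AizenmanBurchard1999 Thm 3 from a single-tube bound) needs an all-n aspect-2
annulus blocking bound, i.e. a statement at least as strong as the target X (lead dossier
Cruxes/DefectDimension/NOTES.md §3); the live r2/r3 lines (slab-flow-constant core,
halfspace-polarisation) consume no power saving, so an item 'DefectDimension → BudgetTightness'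
would be costume. Negative side landed: Theorems/DefectDimension/Negative/AllOpenCutsets (false at p
= 1: every cutset ≥ (2n+1)² open edges), Negative/Subcritical. [Zhang2000, RossignolTheret2018,
BarskyGrimmettNewman1991, arXiv:math/9801027, doi:10.1103/physreve.86.061101]
#9 ZhangBase (support, PROVED: ZhangBase_proof) — Zhang's base rung L0 in probability form: for
every ε > 0, P_{p_c}(the annulus B(n) → ∂B(2n) can be blocked by closing at most εn² edges) → 1.
Provable now from BarskyGrimmettNewman1991_Z3_holds: (i) last-exit/six-slab lemma — every path
inside B(2n) from B(n) to ∂B(2n) crosses one of the six face slabs Q_i = {x ∈ B(2n) : n+1 ≤ ±x_i ≤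
2n} from its inner to its outer face inside Q_i, so MinCut(annulus) ≤ Σ_i MinCut(Q_i); (ii)
Rossignol–Théret cutset in Q_i (RT18 Prop 3.9, pp.16–17, Bernoulli case): W = vertices of Q_i at
height < ℓ joined inside Q_i ∩ {height < ℓ} to the inner face, F = Δ_{Q_i}W is a cutset whose open
edges sit under vertices at height ℓ−1 joined down to the inner face, so E#open(F) ≤
(4n+1)²·P_{p_c}(half-space arm to distance ℓ−1) (lattice symmetries: BondPercolationSymmetry.lean);
(iii) the half-space arm probability → 0 as ℓ → ∞ because θ_ℍ(p_c) = 0 (continuity from above); (iv)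
Markov. [difficulty: M] [Zhang2000, RossignolTheret2018, BarskyGrimmettNewman1991, Grimmett1999]
#9 DefectDimensionOfQuantBGN (support, PROVED: defectDimensionOfQuantBGN_proof) — a polynomial rate
in Barsky–Grimmett–Newman — the hypothesis is VERBATIM PercLowPointHalfSpace.QuantitativeBGN (stmt
of route-CriticalPhenomena-PercLowPointHalfSpace): P_{p_c}(C_ℍ(0) reaches sup-distance r) ≤ C r^(−a)
— implies the (dropped) L1 power saving, inlined, with c = a/2: steps (i)–(ii) of ZhangBase with ℓ =
n give E MinCut(n,2n) ≤ 6(4n+1)² C (n−1)^(−a), then Markov at level n^(2−a/2). Links the two routes: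
a rate in BGN is at least as hard as rung L1; kept after the drop of DefectDimension as the recorded
one-line corollary. [difficulty: M] [RossignolTheret2018, Zhang2000, BarskyGrimmettNewman1991]
#9 BlockingVanishesOfTheta (support, PROVED: BlockingVanishesOfTheta_proof) — if θ(p) > 0 on ℤ³ then
for every λ ≥ 2 the probability that the annulus B(n) → ∂B(λn) is blocked tends to 0 as n → ∞.
Proof: {blocked} ⊆ {no x ∈ B(n) lies in an infinite cluster} (an infinite open path from x ∈ B(n)
reaches innerBoundary(B(λn)) before leaving B(λn)), and these events decrease to {no infinite
cluster}, which is P_p-null when θ(p) > 0 (zero-one law, Grimmett1999 Thm (1.11); in tree: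
Literature.Probability.Percolation.Grimmett1999_prob_exists_percolatesAt_holds); continuity of
measure from above (needs measurability of the blocking events: finite unions of openConnIn events).
Thick/complement form of PercAnnulusCrossing.CrossingTendstoOne. [difficulty: provable-now]
[Grimmett1999]
#9 SufficesTarget (support, PROVED: sufficesTarget_proof) — 'it suffices to show X', formally:
CritAnnulusBlockedIO → BlockingVanishesOfTheta → θ(p_c)=0 (both hypotheses inlined). Proof: if
θ(p_c) ≠ 0 then θ(p_c) > 0 (θ is a probability), so the blocking probability at aspect λ tends to 0,
contradicting ≥ c > 0 infinitely often. Pure logic + order of limits; proved in the planner sketch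
(AssemblyCheck.lean, rc 0, 0 sorry, over definitional copies). [difficulty: provable-now]
[Grimmett1999]
#9 LadderReachesTarget (support, PROVED: ladderReachesTarget_proof) — glue cruxes → target:
BudgetTightness → PinholeClosing → CritAnnulusBlockedIO (the k-step budget descent of `closes`:
budget j ↦ j−1 at aspect λ' ↦ 2λ', i.o.-in-n preserved because PinholeClosing is uniform in n ≥ 1;
budget 0 = the blocked event). [Grimmett1999, Zhang2000]

TWO-LAYER PLAN. Foreseen glued splits (none filed now; k ≤ 3, depth 1): (a) PinholeClosing ⇐
PinholeClosingOne (the case k+1 = 1 → 0: one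
pinhole ⇒ blocked at double aspect) → BudgetDescentStep (k+1 → k reduced to the one-pinhole case on
the annulus with the other k
pinholes frozen) → PinholeClosing; the k = 1 case has an exact handle, the PIVOTAL SPLIT E[N;
blocked] = ((1−p)/p)·E[N; crossed]
(N = number of pivotal edges of the crossing event; independence of ω(e) from pivotality of e),
whence
s_n / P(MinCut = 1) = ((1−p)/p)·E[N | MinCut = 1] / E[N | blocked] — 'pivotal balance' is the
quantitative child.
(b) BudgetTightness ⇐ PolylogBudget (P(MinCut(n,2n) ≤ (log n)^A) ≥ c i.o., the rung after the
dropped L1 power saving) → LogToBounded →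
BudgetTightness; the r2 lead's registered core is instead SlabCutQuadraticIO(p_c) (liminf_h
h²τ_h(p_c) < ∞, Kesten's critical slab flow
constant at its floor) with the dictionary BudgetTightness ⟺ MeanCutBoundedIO ⟺ SlabCutQuadraticIO
(Cruxes/BudgetTightness/PICKED.md).
(c) RETIRED with the drop of DefectDimension (2026-08-16): the repair-recursion engine
RepairRecursion → RepairStep → L1 is analysed in
Cruxes/DefectDimension (3 lines, Disproof.lean, lead dossier NOTES.md); what landed is
line-independent infrastructure (stub_packing,
stub_bootstrap, Negative/AllOpenCutsets, Negative/Subcritical) and the proved corollary glue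
DefectDimensionOfQuantBGN.

KILL CRITERIA. A proof that the critical max-flow diverges — ∀ k λ, P_{p_c}(MinCut(n,λn) ≤ k) → 0 in
d = 3 — refutes BudgetTightness: close
`refuted:BudgetTightness`; it would also refute PercAnnulusCrossing's X_B and every RSW-type crux on
the books (X_B ⇒ r2), major
negative knowledge. A refutation of PinholeClosing (exhibiting k, λ, c with tight budget-(k+1) along
a sequence but budget-k
blocking → 0 at double aspect) closes the route `refuted:PinholeClosing` and pivots the ladder to
'tight but non-zero critical
flow' (feed to chebyshev-variance-sandwich / zero-flux cards as a dossier). The L1 milestone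
DefectDimension was DROPPED on
2026-08-16 (unused-crux repair, not a refutation: not load-bearing, no honest glue, provable content
landed); a future theorem that
near-minimal critical cutsets carry n^(2−o(1)) pinholes i.o. would not touch `closes` but would be
strong evidence against r2's engines
(record it as a log-slow BGN decay). CritAnnulusNonCrossing (PercAnnulusCrossing X_B) proved
elsewhere moots the route (X follows);
QuantitativeBGN proved (route PercLowPointHalfSpace) yields the L1 power saving in one line from
defectDimensionOfQuantBGN_proof; a
d-uniform proof attempt of r2 is self-refuting (d > 6).

NOT DECOMPOSED YET. The Menger/BK dictionary (MaxFlow form of the budget events; E MaxFlow_n ≤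
(1−s_n)/s_n; BK: P(MaxFlow ≥ k) ≤ P(cross)^k) — needs
a max-flow/min-cut notion for finite subgraphs of zdGraph 3 (definition request) and is calibration,
not load-bearing; cut-AREA
control for near-minimal critical cutsets (Kesten1987, Zhang2017: minimal cutsets of area ≤ βn²
w.h.p.) which would improve the
brute-force pinhole entropy from n³ to n²; the repair recursion's constants (m, q, seam terms); the
k = 1 pivotal-balance child;
site percolation and general d versions; any use of the budget ladder below p_c (near-critical
window) — all layer-2 or later.

CHEAPEST FALSIFIER. Numerics first (kit, ≈ 1 cpu-hour): sample bond configurations of B(2n), B(4n)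
at p_c(ℤ³) = 0.2488126 for n = 8, 16, 32, 64 and
compute MaxFlow(n,2n), MaxFlow(n,4n) exactly (Dinic / push–relabel, unit capacities, super-source on
box 3 n, super-sink on the
inner boundary): the route predicts the law of MaxFlow_n STABILISES (tight, P(MaxFlow = 0) and
P(MaxFlow ≤ 1) → constants in
(0,1), E MaxFlow_n = O(1)); an upward drift of the median MaxFlow_n (even logarithmic) endangers r2
and with it every RSW-type
route; a stable law with P(MaxFlow(n,4n) = 0 | MaxFlow(n,2n) ≤ 1)-type ratios bounded below supports
r3. Not run here (plancard
seat, one-shot; galaxy/compute queues saturated this session). Theory lookup second: any printed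
claim on the number of
edge-disjoint critical crossings in d = 3 (none found: Aizenman1997 treats d = 2 and d > 6 only;
BCKS1999 is conditional).

NUMBERS. p_c(ℤ³, bond) = 0.2488126(5); wrapping probability R_c^(x) = 0.25780(6) ∈ (0,1) and β/ν =
0.47705(15) at p_c(ℤ³) (arXiv:1302.0421,
numerical); correlation-length exponent ν ≈ 0.876 so pivotal counts scale like n^(1/ν) ≈ n^1.14 ≪ n²
(heuristic input for the
k = 1 child); d > 6: ≍ L^(d−6) spanning clusters and spanning probability → 1 (Aizenman1997 Thm 4, η
= 0); flow constant:
ν_G > 0 ⟺ G({0}) < 1 − p_c(d) (Zhang2000 = RossignolTheret2018 Thm 2.3), ν = 0 at G({0}) ≥ 1 −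
p_c(d) via Grimmett1999 Thm (7.35)
(RossignolTheret2018 Prop 3.9). Items at open: 9 (1 target, 3 cruxes, 4 support, 1 assembly); after
the 2026-08-16 repairs
(LadderReachesTarget added, DefectDimension dropped): 9 (1 target, 2 cruxes r2/r3 = the two open
leaves of `closes`, 5 support all
proved, 1 assembly proved). Numerics since open (kit j008958/j009909/j011876,
Cruxes/BudgetTightness/Numerics-*.md): the critical
min-cut law is TIGHT — E MinCut(n,2n) ≈ 24→31 for n = 4→32 (increments per doubling 3.7, 2.1, 1.2),
E MinCut(n,4n) ≈ 6.2, typical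
value 4/3/2–3 at aspect 8/12/16 with P(blocked) ≈ 0.05–0.09 / 0.12–0.19 / 0.24–0.28 (n ≤ 6); slab
h²τ_h(p_c) ∈ [0.62, 0.68] for
h ∈ [8, 64].

DEFINITION REQUESTS. Largely met since open (`minOpenCutIn` in
Literature/Probability/Percolation/MinOpenCut.lean and Menger
`maxDisjointOpenPathsIn_eq_minOpenCutIn` in MinOpenCutMenger.lean are in the tree); originally:
optional, for the dictionary and for provers who prefer expectations: `IsOpenEdgeCutset` / `minCut`
(minimal
number of open edges on an edge set meeting every path inside a region S between vertex sets A and B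
of a SimpleGraph; equals
the max number of edge-disjoint open A–B paths in S by Menger — Mathlib has no max-flow/min-cut;
Literature has MengerTwo (k = 2)
only), topic Literature/Probability/Percolation; filed after open with `ledger workitem add --kind
definition`. The route's
items do not depend on it: every budget event is typed as 'closing a finite set S of ≤ k edges (ω \
S) destroys the crossing'.

Novelty: Searches (2026-08-15): `lit search --hybrid "maximal flow critical percolation min-cut flow constant
zero"` (12 docs; only
Grimmett1999 §13.1 PDF pp.391–393 relevant, read); `lit search --source crossref "maximal flow
percolation Zhang critical"` (14:
Kesten/Zhang/Rossignol–Théret/Cerf–Théret/Dembin flow LLN–LDP papers, all off-critical); `lit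
vsearch` "maximal number of
edge-disjoint open paths crossing an annulus at the critical probability stays bounded …" (10 docs,
no percolation hit beyond
HvdH2017 p.122, read: lace expansion, irrelevant); `lit frontier CriticalPhenomena --since 2021` (30
rows: planar/CFT/lace, none
on 3-D flows); `lit read doi:10.1214/18-ejp214` pp.5,10,16–17 (RT18 Thm 2.3, Prop 3.9 read);
OpenAlex budget exhausted, zbMATH 0,
`lit galaxy search … --star all/pdf` saturated ×3 this session (the card's own galaxy hit
pdf:-8950068359828901240 = RT18
stands); the 9 route files and the related cards of the sub (136 cards; chebyshev-variance-sandwich,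
dyadic-shell-borel-cantelli,
zero-flux-last-order-parameter, blockers-glue-tassion-on-cutsets read in full).
Nearest prior art found: Zhang2000 (doi:10.1023/a:1018631726709) = RossignolTheret2018 Thm 2.3 /
Prop 3.9 (arXiv:1707.08766): the
base rung ν(p_c) = 0 in all d, and they stop there; Aizenman1997 + BorgsChayesKestenSpencer1999:
tightness of spanning
structures ⟺ hyperscaling (d = 2 rigorous, d > 6 refuted) — r2 is that statement dualised by Menger
along a subsequence;
route PercAnnulusCrossing / BenjaminiKa  [refs: 10.1214/18-ejp214`, 10.1023/a:1018631726709, 1707.08766, 1512.09107, doi:10.1214/18-ejp214, doi:10.1023/a, Grimmett1999, Zhang2000, RossignolTheret2018, Aizenman1997, BorgsChayesKestenSpencer1999, BenjaminiKalai2018, NewmanTassionWu2017]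

Barriers (technique_class: maxflow-mincut budget-ladder flow-constant RSW-dual): - technique_class: maxflow-mincut budget-ladder flow-constant RSW-dual
- Literature.Barriers.CriticalPhenomena.TransverseCrossingsNeedNotMeet: evaded by design — the
composed objects are edge cutsets (a union of cutsets of the six face slabs is a cutset of the
annulus; budgets add), never open paths; the only topology used is the last-exit lemma of ZhangBase;
conceded that r3's eventual proof must compare near-closed cutsets across scales without the planar
ORDER of landing points (Tassion/KST), which is where the barrier's substance reappears.
- Literature.Barriers.CriticalPhenomena.SpanningClustersAboveSix: APPLIES to the letter to X and r2
(for d > 6 under η = 0 the spanning probability → 1 and MaxFlow ≥ #spanning clusters ≍ n^(d−6) → ∞,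
SpanningClustersAboveSix.not_bounded_away_from_one); declared, not evaded: r2 must use d = 3 and a
d-uniform proof attempt is a kill criterion; ZhangBase and plausibly DefectDimension are
dimension-free and therefore carry no d < 6 information (they are rungs, not the crux).
- Literature.Barriers.CriticalPhenomena.SprinklingRenormalisation: not engaged — single parameter p
= p_c throughout, no block renormalisation in p, no 'extra money'; the repair recursion renormalises
the COST of blocking at fixed p.
- Literature.Barriers.CriticalPhenomena.SlabLimitUniformControl: not engaged — no slab limit k → ∞;
slabs appear only as the six finite face slabs of one annulus.
- Literature.Barriers.CriticalPhenomena.RandomClusterFirstOrder: the target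

History (route lifecycle, newest last):
- 2026-08-16T06:26:05Z · rev 5: dropped DefectDimension — @note.txt (planner-rrepair-CriticalPhenomena-PercBudgetLa-3fa2cc6f-0)

sub-problem: PercolationContinuityZ3 · status: open · opened planner-plancard-CriticalPhenomena-Percolatio-368b0abf-0 2026-08-15T11:40:31Z · rev 5 · ledger route-CriticalPhenomena-PercBudgetLadder
GENERATED by the gate from the ledger (D-0016/17). Provers cite these decls: `theorem foo : Summit.CriticalPhenomena.PercolationContinuityZ3.Theses.PercBudgetLadder.<Decl> := …` in Summits/CriticalPhenomena/PercolationContinuityZ3/Theorems/<Name>.lean.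
-/

namespace Summit.CriticalPhenomena.PercolationContinuityZ3.Theses.PercBudgetLadder

open scoped BigOperators Topology Manifold Classical MeasureTheory ProbabilityTheory Matrix InnerProductSpace ComplexConjugate ContinuousMap
open Filter Set Function TopologicalSpace MeasureTheory

attribute [summit_statement] _root_.PercolationContinuityZ3

/-- item stmt-CriticalPhenomena-5247 · target · rank 0 · open · by planner
why it might fail: False iff P_{p_c}(A(n,λn) crossed)→1 for all λ — PROVED for d>6 under η=0 (SpanningClustersAboveSix.annulusCrossing_tendsto_one) though θ(p_c)=0 there; d=3 support is numerics only (wrapping prob. ≈0.258, arXiv:1302.0421) and slabs, whose RSW constants →0 in the thickness (NTW2017).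
sources: Aizenman1997, Literature.Barriers.CriticalPhenomena.SpanningClustersAboveSix, ChatterjeeHanson2020, BorgsChayesKestenSpencer1999, WangZhouZhangGaroniDeng2013, arXiv:1302.0421
[target] X: there are λ ≥ 2 and c > 0 such that for infinitely many n, with P_{p_c(ℤ³)}-probability
≥ c there is no open path inside B(λn) from box 3 n to innerBoundary (zdGraph 3) (box 3 (λn)) (the
i.o., aspect-λ weakening of PercAnnulusCrossing.CritAnnulusNonCrossing; numerically blocking
probabilities converge to constants in (0,1)). -/
@[route_item "route-CriticalPhenomena-PercBudgetLadder"]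
def CritAnnulusBlockedIO : Prop :=
  ∃ (l : ℕ) (c : ℝ), 2 ≤ l ∧ 0 < c ∧ ∀ N : ℕ, ∃ n : ℕ, N ≤ n ∧ c ≤ (Literature.Probability.Percolation.bondPercolation (Literature.Probability.LatticeModels.zdGraph 3) (Literature.Probability.Percolation.criticalProbI 3)).real {ω | ¬ ∃ x ∈ Literature.Probability.LatticeModels.box 3 n, ∃ y ∈ Literature.Probability.LatticeModels.innerBoundary (Literature.Probability.LatticeModels.zdGraph 3) (Literature.Probability.LatticeModels.box 3 (l * n)), ω ∈ Literature.Probability.Percolation.openConnIn ↑(Literature.Probability.LatticeModels.box 3 (l * n)) x y}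

/-- item stmt-CriticalPhenomena-5248 · crux · rank 2 · open · by planner
why it might fail: False iff critical max-flow MinCut(n,λn)→∞ in prob. for all λ, as for d>6 (≥c·n^(d−6) spanning clusters: Aizenman1997 Thm 4; ChatterjeeHanson2020 §3); d=3 evidence = numerics on tight CLUSTER counts (cond-mat/0207605), blind to edge-disjoint crossings in one cluster; sole rigorous bound o(n²).
sources: Aizenman1997, BorgsChayesKestenSpencer1999, Zhang2000, RossignolTheret2018, ChatterjeeHanson2020, arXiv:cond-mat/0207605
[crux] bounded-budget tightness at p_c (card rung L3 with k free): there are k, λ ≥ 2 and c > 0 such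
that for infinitely many n, with probability ≥ c the open crossings of the annulus B(n) → ∂B(λn)
inside B(λn) can all be destroyed by closing at most k edges (MinCut(n,λn) ≤ k; by Menger: at most k
edge-disjoint open crossings; by BK it is implied by X, so it is the NECESSARY half of the ladder
and the Menger dual of 'tight number of disjoint spanning structures', the d<6 side of
hyperscaling). [difficulty: open-problem] -/
@[route_item "route-CriticalPhenomena-PercBudgetLadder"]
def BudgetTightness : Prop :=
  ∃ (k l : ℕ) (c : ℝ), 2 ≤ l ∧ 0 < c ∧ ∀ N : ℕ, ∃ n : ℕ, N ≤ n ∧ c ≤ (Literature.Probability.Percolation.bondPercolation (Literature.Probability.LatticeModels.zdGraph 3) (Literature.Probability.Percolation.criticalProbI 3)).real {ω | ∃ S : Finset (Sym2 (Literature.Probability.LatticeModels.Site 3)), S.card ≤ k ∧ ¬ ∃ x ∈ Literature.Probability.LatticeModels.box 3 n, ∃ y ∈ Literature.Probability.LatticeModels.innerBoundary (Literature.Probability.LatticeModels.zdGraph 3) (Literature.Probability.LatticeModels.box 3 (l * n)), (ω \ ↑S) ∈ Literature.Probability.Percolation.openConnIn ↑(Literature.Probability.LatticeModels.box 3 (l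 * n)) x y}

/-- item stmt-CriticalPhenomena-5249 · crux · rank 3 · open · by planner
why it might fail: Closing a pinhole by force pays the entropy (n²–n³) of its position: c′(n)→0; a uniform c′ is an RSW comparison of near-closed cutsets across scales with no d=3 tool (Tassion2016/KST2023 use the planar ORDER of landing points; slab constants →0, NTW2017); false if budgets tight yet P(MinCut=0)→0.
sources: Grimmett1999, Tassion2016, KohlerSchindlerTassion2023, NewmanTassionWu2017, BenjaminiKalai2018, DuminilCopinSidoraviciusTassion2016
[crux] pinhole closing = RSW in the budget variable (card rung L3→L4, made uniform): for all k, λ ≥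
2 and c > 0 there is c' > 0 such that for EVERY n ≥ 1, if with probability ≥ c the annulus B(n) →
∂B(λn) can be blocked by closing at most k+1 edges, then with probability ≥ c' the thicker annulus
B(n) → ∂B(2λn) can be blocked by closing at most k edges. With r2 and a k-step descent this yields X
at aspect 2^k λ. Off-critical content is nil by design (stated at p_c); brute-force finite energy
gives only c'(n) ≍ c·n^(−3) (entropy of the pinhole position), so the content is 'one pinhole costs
O(1), given room'. [deps: BudgetTightness] [difficulty: open-problem] -/
@[route_item "route-CriticalPhenomena-PercBudgetLadder"]
def PinholeClosing : Prop :=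
  ∀ (k l : ℕ) (c : ℝ), 2 ≤ l → 0 < c → ∃ c' : ℝ, 0 < c' ∧ ∀ n : ℕ, 1 ≤ n → c ≤ (Literature.Probability.Percolation.bondPercolation (Literature.Probability.LatticeModels.zdGraph 3) (Literature.Probability.Percolation.criticalProbI 3)).real {ω | ∃ S : Finset (Sym2 (Literature.Probability.LatticeModels.Site 3)), S.card ≤ k + 1 ∧ ¬ ∃ x ∈ Literature.Probability.LatticeModels.box 3 n, ∃ y ∈ Literature.Probability.LatticeModels.innerBoundary (Literature.Probability.LatticeModels.zdGraph 3) (Literature.Probability.LatticeModels.box 3 (l * n)), (ω \ ↑S) ∈ Literature.Probability.Percolation.openConnIn ↑(Literature.Probability.LatticeModels.box 3 (l * n)) x y} → c' ≤ (Literature.Probability.Percolation.bondPercolation (Literature.Probability.LatticeModels.zdGraph 3) (Literature.Probability.Percolation.criticalProbI 3)).real {ω | ∃ S : Finset (Sym2 (Literature.Probability.LatticeModels.Site 3)), S.card ≤ k ∧ ¬ ∃ x ∈ Literature.Probability.LatticeModels.box 3 n, ∃ y ∈ Literature.Probability.LatticeModels.innerBoundary (Literature.Probability.LatticeModels.zdGraph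 3) (Literature.Probability.LatticeModels.box 3 (2 * l * n)), (ω \ ↑S) ∈ Literature.Probability.Percolation.openConnIn ↑(Literature.Probability.LatticeModels.box 3 (2 * l * n)) x y}

/-- item stmt-CriticalPhenomena-14173 · support · rank 9 · closed · proved by Summit.CriticalPhenomena.PercolationContinuityZ3.Theorems.ladderReachesTarget_proof @ 20a055b94c44 (prover) · by planner
[support] glue Crux… → Target (route-choice repair of `route.target-unreachable`): the two
load-bearing cruxes reach the target X — BudgetTightness → PinholeClosing → CritAnnulusBlockedIO.
Pure logic: from BudgetTightness get (k, λ, c); apply PinholeClosing k times (budget j ↦ j−1 at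
aspect λ' ↦ 2λ', the i.o.-in-n lower bound is preserved since PinholeClosing is uniform in n ≥ 1),
reaching budget 0 at aspect 2^k·λ ≥ 2; budget 0 is literally the blocked event (S.card ≤ 0 forces S
= ∅ and ω \ ∅ = ω), i.e. CritAnnulusBlockedIO. This is exactly the first half of the route's
certified deciding theorem `closes`; proved sorry-free against the real decls in the planner's
Sketch.lean (lean rc 0, 0 sorry, axioms propext / Classical.choice / Quot.sound) — a prover can land
it verbatim as Theorems/PercBudgetLadderLadderReachesTarget.lean. [deps: BudgetTightness,
PinholeClosing, CritAnnulusBlockedIO] [difficulty: provable-now] [sources: Grimmett1999 §11.7 (d = 2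
RSW descent template), Zhang2000] -/
@[route_item "route-CriticalPhenomena-PercBudgetLadder"]
def LadderReachesTarget : Prop :=
  BudgetTightness → PinholeClosing → CritAnnulusBlockedIO

/-- item stmt-CriticalPhenomena-5251 · support · rank 9 · closed · proved by Summit.CriticalPhenomena.PercolationContinuityZ3.Theorems.ZhangBase_proof @ 0c1e476ca277 (prover) · by planner
sources: Zhang2000, RossignolTheret2018, BarskyGrimmettNewman1991, Grimmett1999
[support] Zhang's base rung L0 in probability form: for every ε > 0, P_{p_c}(the annulus B(n) →
∂B(2n) can be blocked by closing at most εn² edges) → 1. Provable now from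
BarskyGrimmettNewman1991_Z3_holds: (i) last-exit/six-slab lemma — every path inside B(2n) from B(n)
to ∂B(2n) crosses one of the six face slabs Q_i = {x ∈ B(2n) : n+1 ≤ ±x_i ≤ 2n} from its inner to
its outer face inside Q_i, so MinCut(annulus) ≤ Σ_i MinCut(Q_i); (ii) Rossignol–Théret cutset in Q_i
(RT18 Prop 3.9, pp.16–17, Bernoulli case): W = vertices of Q_i at height < ℓ joined inside Q_i ∩
{height < ℓ} to the inner face, F = Δ_{Q_i}W is a cutset whose open edges sit under vertices at
height ℓ−1 joined down to the inner face, so E#open(F) ≤ (4n+1)²·P_{p_c}(half-space arm to distance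
ℓ−1) (lattice symmetries: BondPercolationSymmetry.lean); (iii) the half-space arm probability → 0 as
ℓ → ∞ because θ_ℍ(p_c) = 0 (continuity from above); (iv) Markov. [difficulty: M] -/
@[route_item "route-CriticalPhenomena-PercBudgetLadder"]
def ZhangBase : Prop :=
  ∀ ε : ℝ, 0 < ε → Filter.Tendsto (fun n : ℕ => (Literature.Probability.Percolation.bondPercolation (Literature.Probability.LatticeModels.zdGraph 3) (Literature.Probability.Percolation.criticalProbI 3)).real {ω | ∃ S : Finset (Sym2 (Literature.Probability.LatticeModels.Site 3)), (S.card : ℝ) ≤ ε * (n : ℝ) ^ 2 ∧ ¬ ∃ x ∈ Literature.Probability.LatticeModels.box 3 n, ∃ y ∈ Literature.Probability.LatticeModels.innerBoundary (Literature.Probability.LatticeModels.zdGraph 3) (Literature.Probability.LatticeModels.box 3 (2 * n)), (ω \ ↑S) ∈ Literature.Probability.Percolation.openConnIn ↑(Literature.Probability.LatticeModels.box 3 (2 * n)) x y}) Filter.atTop (nhds 1)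

/-- item stmt-CriticalPhenomena-5252 · support · rank 9 · closed · proved by Summit.CriticalPhenomena.PercolationContinuityZ3.Theorems.defectDimensionOfQuantBGN_proof (prover) · by planner
sources: RossignolTheret2018, Zhang2000, BarskyGrimmettNewman1991
[support] a polynomial rate in Barsky–Grimmett–Newman — the hypothesis is VERBATIM
PercLowPointHalfSpace.QuantitativeBGN (stmt of route-CriticalPhenomena-PercLowPointHalfSpace):
P_{p_c}(C_ℍ(0) reaches sup-distance r) ≤ C r^(−a) — implies DefectDimension with c = a/2: steps
(i)–(ii) of ZhangBase with ℓ = n give E MinCut(n,2n) ≤ 6(4n+1)² C (n−1)^(−a), then Markov at level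
n^(2−a/2). Links the two routes: a rate in BGN is at least as hard as rung L1. [difficulty: M] -/
@[route_item "route-CriticalPhenomena-PercBudgetLadder"]
def DefectDimensionOfQuantBGN : Prop :=
  (∃ a C : ℝ, 0 < a ∧ ∀ r : ℕ, 1 ≤ r → (Literature.Probability.Percolation.bondPercolation (Literature.Probability.LatticeModels.zdGraph 3) (Literature.Probability.Percolation.criticalProbI 3)).real {ω | ∃ y : Literature.Probability.LatticeModels.Site 3, (∃ i : Fin 3, (r : ℤ) ≤ |y i|) ∧ ω ∈ Literature.Probability.Percolation.openConnIn {x : Literature.Probability.LatticeModels.Site 3 | 0 ≤ x 0} 0 y} ≤ C * (r : ℝ) ^ (-a)) → (∃ c : ℝ, 0 < c ∧ Filter.Tendsto (fun n : ℕ => (Literature.Probability.Percolation.bondPercolation (Literature.Probability.LatticeModels.zdGraph 3) (Literature.Probability.Percolation.criticalProbI 3)).real {ω | ∃ S : Finset (Sym2 (Literature.Probability.LatticeModels.Site 3)), (S.card : ℝ) ≤ (n : ℝ) ^ (2 - c) ∧ ¬ ∃ x ∈ Literature.Probability.LatticeModels.box 3 n, ∃ y ∈ Literature.Probability.LatticeModels.innerBoundary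 (Literature.Probability.LatticeModels.zdGraph 3) (Literature.Probability.LatticeModels.box 3 (2 * n)), (ω \ ↑S) ∈ Literature.Probability.Percolation.openConnIn ↑(Literature.Probability.LatticeModels.box 3 (2 * n)) x y}) Filter.atTop (nhds 1))

/-- item stmt-CriticalPhenomena-5253 · support · rank 9 · closed · proved by Summit.CriticalPhenomena.PercolationContinuityZ3.Theorems.BlockingVanishesOfTheta_proof (prover) · by planner
sources: Grimmett1999
[support] if θ(p) > 0 on ℤ³ then for every λ ≥ 2 the probability that the annulus B(n) → ∂B(λn) is
blocked tends to 0 as n → ∞. Proof: {blocked} ⊆ {no x ∈ B(n) lies in an infinite cluster} (an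
infinite open path from x ∈ B(n) reaches innerBoundary(B(λn)) before leaving B(λn)), and these
events decrease to {no infinite cluster}, which is P_p-null when θ(p) > 0 (zero-one law,
Grimmett1999 Thm (1.11); in tree:
Literature.Probability.Percolation.Grimmett1999_prob_exists_percolatesAt_holds); continuity of
measure from above (needs measurability of the blocking events: finite unions of openConnIn events).
Thick/complement form of PercAnnulusCrossing.CrossingTendstoOne. [difficulty: provable-now] -/
@[route_item "route-CriticalPhenomena-PercBudgetLadder"]
def BlockingVanishesOfTheta : Prop :=
  ∀ p : unitInterval, 0 < Literature.Probability.Percolation.theta (Literature.Probability.LatticeModels.zdGraph 3) 0 p → ∀ l : ℕ, 2 ≤ l → Filter.Tendsto (fun n : ℕ => (Literature.Probability.Percolation.bondPercolation (Literature.Probability.LatticeModels.zdGraph 3) p).real {ω | ¬ ∃ x ∈ Literature.Probability.LatticeModels.box 3 n, ∃ y ∈ Literature.Probability.LatticeModels.innerBoundary (Literature.Probability.LatticeModels.zdGraph 3) (Literature.Probability.LatticeModels.box 3 (l * n)), ω ∈ Literature.Probability.Percolation.openConnIn ↑(Literature.Probability.LatticeModels.box 3 (l * n)) x y}) Filter.atTop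 (nhds 0)

/-- item stmt-CriticalPhenomena-5254 · support · rank 9 · closed · proved by Summit.CriticalPhenomena.PercolationContinuityZ3.Theorems.sufficesTarget_proof (prover) · by planner
sources: Grimmett1999
[support] 'it suffices to show X', formally: CritAnnulusBlockedIO → BlockingVanishesOfTheta →
θ(p_c)=0 (both hypotheses inlined). Proof: if θ(p_c) ≠ 0 then θ(p_c) > 0 (θ is a probability), so
the blocking probability at aspect λ tends to 0, contradicting ≥ c > 0 infinitely often. Pure logic
+ order of limits; proved in the planner sketch (AssemblyCheck.lean, rc 0, 0 sorry, over
definitional copies). [difficulty: provable-now] -/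
@[route_item "route-CriticalPhenomena-PercBudgetLadder"]
def SufficesTarget : Prop :=
  (∃ (l : ℕ) (c : ℝ), 2 ≤ l ∧ 0 < c ∧ ∀ N : ℕ, ∃ n : ℕ, N ≤ n ∧ c ≤ (Literature.Probability.Percolation.bondPercolation (Literature.Probability.LatticeModels.zdGraph 3) (Literature.Probability.Percolation.criticalProbI 3)).real {ω | ¬ ∃ x ∈ Literature.Probability.LatticeModels.box 3 n, ∃ y ∈ Literature.Probability.LatticeModels.innerBoundary (Literature.Probability.LatticeModels.zdGraph 3) (Literature.Probability.LatticeModels.box 3 (l * n)), ω ∈ Literature.Probability.Percolation.openConnIn ↑(Literature.Probability.LatticeModels.box 3 (l * n)) x y}) → (∀ p : unitInterval, 0 < Literature.Probability.Percolation.theta (Literature.Probability.LatticeModels.zdGraph 3) 0 p → ∀ l : ℕ, 2 ≤ l → Filter.Tendsto (fun n : ℕ => (Literature.Probability.Percolation.bondPercolation (Literature.Probability.LatticeModels.zdGraph 3) p).real {ω | ¬ ∃ x ∈ Literature.Probability.LatticeModels.box 3 n, ∃ y ∈ Literature.Probability.LatticeModels.innerBoundary (Literature.Probability.LatticeModels.zdGraph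 3) (Literature.Probability.LatticeModels.box 3 (l * n)), ω ∈ Literature.Probability.Percolation.openConnIn ↑(Literature.Probability.LatticeModels.box 3 (l * n)) x y}) Filter.atTop (nhds 0)) → PercolationContinuityZ3

/-- item stmt-CriticalPhenomena-5255 · assembly · rank 1 · closed · proved by Summit.CriticalPhenomena.PercolationContinuityZ3.Theorems.percBudgetLadderAssembly_proof @ 20a055b94c44 (prover) · by planner
sources: Grimmett1999, Zhang2000
[assembly] BudgetTightness → PinholeClosing → BlockingVanishesOfTheta → PercolationContinuityZ3
(k-step budget descent, then the zero-one-law contradiction at p_c). -/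
@[route_item "route-CriticalPhenomena-PercBudgetLadder"]
def Assembly : Prop :=
  BudgetTightness → PinholeClosing → BlockingVanishesOfTheta → PercolationContinuityZ3

/-! D-0027 §2.1 — DECIDING THEOREM (planner-authored via `route open/edit --closes-file`; by planner-rrepair-CriticalPhenomena-PercBudgetLa-56d42713-g2-0 2026-08-15T16:53:46Z):
its hypotheses are this route's items and its conclusion the sub-problem Statement (glue_lint), and it elaborates with this file. -/

@[closes "route-CriticalPhenomena-PercBudgetLadder"] theorem closes : BudgetTightness → PinholeClosing → BlockingVanishesOfTheta →
    _root_.PercolationContinuityZ3 := by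
  intro hBT hPC hBV
  -- k-step descent: an i.o. lower bound at budget k and aspect l gives one at budget 0 and aspect 2^k l
  have descent : ∀ k : ℕ, ∀ (l : ℕ) (c : ℝ), 2 ≤ l → 0 < c →
      (∀ N : ℕ, ∃ n : ℕ, N ≤ n ∧ c ≤ (Literature.Probability.Percolation.bondPercolation
        (Literature.Probability.LatticeModels.zdGraph 3)
        (Literature.Probability.Percolation.criticalProbI 3)).real
        {ω | ∃ S : Finset (Sym2 (Literature.Probability.LatticeModels.Site 3)), S.card ≤ k ∧
          ¬ ∃ x ∈ Literature.Probability.LatticeModels.box 3 n,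
            ∃ y ∈ Literature.Probability.LatticeModels.innerBoundary
              (Literature.Probability.LatticeModels.zdGraph 3)
              (Literature.Probability.LatticeModels.box 3 (l * n)),
            (ω \ ↑S) ∈ Literature.Probability.Percolation.openConnIn
              ↑(Literature.Probability.LatticeModels.box 3 (l * n)) x y}) →
      ∃ (l' : ℕ) (c' : ℝ), 2 ≤ l' ∧ 0 < c' ∧
      (∀ N : ℕ, ∃ n : ℕ, N ≤ n ∧ c' ≤ (Literature.Probability.Percolation.bondPercolation
        (Literature.Probability.LatticeModels.zdGraph 3)
        (Literature.Probability.Percolation.criticalProbI 3)).real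
        {ω | ∃ S : Finset (Sym2 (Literature.Probability.LatticeModels.Site 3)), S.card ≤ 0 ∧
          ¬ ∃ x ∈ Literature.Probability.LatticeModels.box 3 n,
            ∃ y ∈ Literature.Probability.LatticeModels.innerBoundary
              (Literature.Probability.LatticeModels.zdGraph 3)
              (Literature.Probability.LatticeModels.box 3 (l' * n)),
            (ω \ ↑S) ∈ Literature.Probability.Percolation.openConnIn
              ↑(Literature.Probability.LatticeModels.box 3 (l' * n)) x y}) := by
    intro k
    induction k with
    | zero =>
      intro l c hl hc h
      exact ⟨l, c, hl, hc, h⟩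
    | succ k ih =>
      intro l c hl hc h
      obtain ⟨c', hc', hstep⟩ := hPC k l c hl hc
      refine ih (2 * l) c' (by omega) hc' ?_
      intro N
      obtain ⟨n, hn, hbound⟩ := h (N + 1)
      exact ⟨n, by omega, hstep n (by omega) hbound⟩
  obtain ⟨k, l, c, hl, hc, hio⟩ := hBT
  obtain ⟨l', c', hl', hc', hio'⟩ := descent k l c hl hc hio
  -- budget 0 is the blocked event
  have hblocked : ∀ N : ℕ, ∃ n : ℕ, N ≤ n ∧ c' ≤ (Literature.Probability.Percolation.bondPercolation
        (Literature.Probability.LatticeModels.zdGraph 3)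
        (Literature.Probability.Percolation.criticalProbI 3)).real
      {ω | ¬ ∃ x ∈ Literature.Probability.LatticeModels.box 3 n,
            ∃ y ∈ Literature.Probability.LatticeModels.innerBoundary
              (Literature.Probability.LatticeModels.zdGraph 3)
              (Literature.Probability.LatticeModels.box 3 (l' * n)),
            ω ∈ Literature.Probability.Percolation.openConnIn
              ↑(Literature.Probability.LatticeModels.box 3 (l' * n)) x y} := by
    intro N
    obtain ⟨n, hn, hbound⟩ := hio' N
    refine ⟨n, hn, ?_⟩
    have hset :
        {ω : Set (Sym2 (Literature.Probability.LatticeModels.Site 3)) |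
          ∃ S : Finset (Sym2 (Literature.Probability.LatticeModels.Site 3)), S.card ≤ 0 ∧
            ¬ ∃ x ∈ Literature.Probability.LatticeModels.box 3 n,
              ∃ y ∈ Literature.Probability.LatticeModels.innerBoundary
                (Literature.Probability.LatticeModels.zdGraph 3)
                (Literature.Probability.LatticeModels.box 3 (l' * n)),
              (ω \ ↑S) ∈ Literature.Probability.Percolation.openConnIn
                ↑(Literature.Probability.LatticeModels.box 3 (l' * n)) x y} =
        {ω | ¬ ∃ x ∈ Literature.Probability.LatticeModels.box 3 n,
              ∃ y ∈ Literature.Probability.LatticeModels.innerBoundary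
                (Literature.Probability.LatticeModels.zdGraph 3)
                (Literature.Probability.LatticeModels.box 3 (l' * n)),
              ω ∈ Literature.Probability.Percolation.openConnIn
                ↑(Literature.Probability.LatticeModels.box 3 (l' * n)) x y} := by
      ext ω
      constructor
      · rintro ⟨S, hS, hnot⟩
        have hS0 : S = ∅ := Finset.card_eq_zero.mp (Nat.le_zero.mp hS)
        subst hS0
        simpa using hnot
      · intro hnot
        exact ⟨∅, by simp, by simpa using hnot⟩
    rw [hset] at hbound
    exact hbound
  -- it suffices: θ(p_c) ≠ 0 would make the blocking probability at aspect l' tend to 0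
  by_contra hne
  have h0 : 0 ≤ Literature.Probability.Percolation.theta
      (Literature.Probability.LatticeModels.zdGraph 3) 0
      (Literature.Probability.Percolation.criticalProbI 3) := by
    unfold Literature.Probability.Percolation.theta
    exact MeasureTheory.measureReal_nonneg
  have hpos : 0 < Literature.Probability.Percolation.theta
      (Literature.Probability.LatticeModels.zdGraph 3) 0
      (Literature.Probability.Percolation.criticalProbI 3) :=
    lt_of_le_of_ne h0 (fun h => hne h.symm)
  have hT := hBV (Literature.Probability.Percolation.criticalProbI 3) hpos l' hl'
  have hev := hT.eventually (gt_mem_nhds hc')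
  obtain ⟨N, hN⟩ := Filter.eventually_atTop.mp hev
  obtain ⟨n, hn, hbound⟩ := hblocked N
  exact absurd (hN n hn) (not_lt.mpr hbound)

end Summit.CriticalPhenomena.PercolationContinuityZ3.Theses.PercBudgetLadder
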